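import Mathlib
import Summits.ValiantsHypothesis.ValiantsHypothesis.Theorems.LiouvilleSarnakAlignedTypeICharactersMod2nBilinearSievePCS
import HarnessLib

/-!
# Route LiouvilleSarnak — support `AlignedTypeI` (stmt-ValiantsHypothesis-21040), line `characters_mod_2n`:
# non-principal characters to `2`-power moduli and their primitive inducing characters, on primes

Glue towards the hypothesis of `alignedTypeI_of_logWeightedPrimeCharSums` (`…BilinearSievePCS.lean`): the printed input
(Banks–Shparlinski 2019, Thm 2.2) is stated for PRIMITIVE characters `χ (mod 2^γ)`, while the hypothesis ranges over all
non-principal `ψ (mod 2^k)`.  Def-free: every non-principal `ψ (mod 2^k)` has conductor `2^j`, `1 ≤ j ≤ k`, and agrees with its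
primitive character `χ (mod 2^j)` at EVERY prime (`exists_primitive_twoPower_eq_on_primes`; at odd primes by Mathlib's
`primitiveCharacter_apply_of_isCoprime`, at `p = 2` both vanish), hence all prime sums `Σ_{p ≤ t} w(p) ψ(p)` and
`Σ_{p ≤ t} w(p) χ(p)` coincide (`sum_primes_eq_of_eq_on_primes`).

HONEST FRAMING. Bookkeeping only; `AlignedTypeI` is NOT closed here; nothing bears on `VP ≠ VNP` (NOT proved).
-/

set_option linter.dupNamespace false

noncomputable section

namespace Summit.ValiantsHypothesis.ValiantsHypothesis.Theorems.LiouvilleSarnak.AlignedTypeI.CharactersModTwoN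

open Finset
open scoped BigOperators

/-- A Dirichlet character to a `2`-power modulus `2^j`, `j ≥ 1`, vanishes at `2`. [folklore] -/
theorem char_twoPower_apply_two {j : ℕ} (hj : 1 ≤ j) (χ : DirichletCharacter ℂ (2 ^ j)) :
    χ ((2 : ℕ) : ZMod (2 ^ j)) = 0 := by
  refine χ.map_nonunit ?_
  rw [ZMod.isUnit_prime_iff_not_dvd Nat.prime_two, not_not]
  exact dvd_pow_self 2 (by omega)

/-- **Non-principal characters mod `2^k` on primes.**  For `ψ ≠ 1` mod `2^k` there are `1 ≤ j ≤ k` and a PRIMITIVE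
character `χ` mod `2^j` (the primitive character inducing `ψ`) with `ψ(p) = χ(p)` for every prime `p`. [folklore] -/
theorem exists_primitive_twoPower_eq_on_primes (k : ℕ) (ψ : DirichletCharacter ℂ (2 ^ k)) (hψ : ψ ≠ 1) :
    ∃ j : ℕ, 1 ≤ j ∧ j ≤ k ∧ ∃ χ : DirichletCharacter ℂ (2 ^ j), χ.IsPrimitive ∧
      ∀ p : ℕ, p.Prime → ψ (p : ZMod (2 ^ k)) = χ (p : ZMod (2 ^ j)) := by
  haveI : NeZero (2 ^ k) := ⟨pow_ne_zero _ two_ne_zero⟩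
  obtain ⟨j, hjk, hdj⟩ := (Nat.dvd_prime_pow Nat.prime_two).mp (DirichletCharacter.conductor_dvd_level ψ)
  have hj1 : 1 ≤ j := by
    by_contra h0
    have hj0 : j = 0 := by omega
    rw [hj0, pow_zero] at hdj
    exact hψ (DirichletCharacter.eq_one_iff_conductor_eq_one.mpr hdj)
  have hk1 : 1 ≤ k := hj1.trans hjk
  refine ⟨j, hj1, hjk, ?_⟩
  rw [← hdj]
  refine ⟨ψ.primitiveCharacter, DirichletCharacter.primitiveCharacter_isPrimitive ψ, fun p hp => ?_⟩
  by_cases hp2 : p = 2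
  · subst hp2
    rw [char_twoPower_apply_two hk1 ψ]
    -- `χ(2) = 0` as well: `2 ∣ conductor = 2^j`
    symm
    refine (ψ.primitiveCharacter).map_nonunit ?_
    rw [ZMod.isUnit_prime_iff_not_dvd Nat.prime_two, not_not, hdj]
    exact dvd_pow_self 2 (by omega)
  · have hcop : Nat.Coprime p (2 ^ k) :=
      Nat.Coprime.pow_right k ((Nat.coprime_primes hp Nat.prime_two).mpr hp2)
    have hcopZ : IsCoprime (p : ℤ) ((2 ^ k : ℕ) : ℤ) := Nat.isCoprime_iff_coprime.mpr hcop
    have h := DirichletCharacter.primitiveCharacter_apply_of_isCoprime ψ hcopZ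
    rw [Int.cast_natCast, Int.cast_natCast] at h
    exact h.symm

/-- Prime sums of two functions that agree on primes coincide. [folklore] -/
theorem sum_primes_eq_of_eq_on_primes {M : Type*} [AddCommMonoid M] (f g : ℕ → M)
    (hfg : ∀ p : ℕ, p.Prime → f p = g p) (s : Finset ℕ) :
    ∑ p ∈ s.filter Nat.Prime, f p = ∑ p ∈ s.filter Nat.Prime, g p :=
  Finset.sum_congr rfl fun p hp => hfg p (Finset.mem_filter.mp hp).2

/-- **Reduction of the log-weighted hypothesis to primitive characters.**  If for all `θ, η > 0` there is `k₁` such that for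
all `k ≥ k₁`, all `1 ≤ j ≤ k`, every PRIMITIVE `χ (mod 2^j)`, every `a ≥ θk` and `t ≥ 2^a`,
`‖Σ_{p ≤ t} (log p) χ(p)‖ ≤ η t`, then the same holds for every non-principal `ψ (mod 2^k)` (the hypothesis of
`alignedTypeI_of_logWeightedPrimeCharSums`). [folklore] -/
theorem logWeighted_of_primitive
    (h : ∀ θ : ℝ, 0 < θ → ∀ η : ℝ, 0 < η → ∃ k₁ : ℕ, ∀ k : ℕ, k₁ ≤ k → ∀ j : ℕ, 1 ≤ j → j ≤ k →
      ∀ χ : DirichletCharacter ℂ (2 ^ j), χ.IsPrimitive → ∀ a : ℕ, θ * k ≤ a → ∀ t : ℕ, 2 ^ a ≤ t →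
        ‖∑ p ∈ (Finset.Iic t).filter Nat.Prime, (Real.log p : ℂ) * χ (p : ZMod (2 ^ j))‖ ≤ η * t) :
    ∀ θ : ℝ, 0 < θ → ∀ η : ℝ, 0 < η → ∃ k₁ : ℕ, ∀ k : ℕ, k₁ ≤ k →
      ∀ ψ : DirichletCharacter ℂ (2 ^ k), ψ ≠ 1 → ∀ a : ℕ, θ * k ≤ a → ∀ t : ℕ, 2 ^ a ≤ t →
        ‖∑ p ∈ (Finset.Iic t).filter Nat.Prime, (Real.log p : ℂ) * ψ (p : ZMod (2 ^ k))‖ ≤ η * t := by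
  intro θ hθ η hη
  obtain ⟨k₁, hk₁⟩ := h θ hθ η hη
  refine ⟨k₁, fun k hk ψ hψ a ha t ht => ?_⟩
  obtain ⟨j, hj1, hjk, χ, hχ, hval⟩ := exists_primitive_twoPower_eq_on_primes k ψ hψ
  rw [sum_primes_eq_of_eq_on_primes (fun p => (Real.log p : ℂ) * ψ (p : ZMod (2 ^ k)))
    (fun p => (Real.log p : ℂ) * χ (p : ZMod (2 ^ j))) (fun p hp => by rw [hval p hp])]
  exact hk₁ k hk j hj1 hjk χ hχ a ha t ht


/-- **`AlignedTypeI` from log-weighted prime sums of PRIMITIVE characters to `2`-power moduli** (CONDITIONAL by arrow, no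
def): if for all `θ, η > 0` there is `k₁` with `‖Σ_{p ≤ t} (log p) χ(p)‖ ≤ η t` for all `k ≥ k₁`, `1 ≤ j ≤ k`, primitive
`χ (mod 2^j)`, `a ≥ θk`, `t ≥ 2^a` — the `θ(x, χ)` form of Banks–Shparlinski 2019 Thm 2.2 (`q = 2^j`, `j ≥ γ₀`) plus PNT in
progressions for the finitely many conductors `2^j < 2^{γ₀}` — then the leaf `AlignedTypeI` holds. [folklore] -/
theorem alignedTypeI_of_primitiveLogWeightedPrimeCharSums
    (h : ∀ θ : ℝ, 0 < θ → ∀ η : ℝ, 0 < η → ∃ k₁ : ℕ, ∀ k : ℕ, k₁ ≤ k → ∀ j : ℕ, 1 ≤ j → j ≤ k →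
      ∀ χ : DirichletCharacter ℂ (2 ^ j), χ.IsPrimitive → ∀ a : ℕ, θ * k ≤ a → ∀ t : ℕ, 2 ^ a ≤ t →
        ‖∑ p ∈ (Finset.Iic t).filter Nat.Prime, (Real.log p : ℂ) * χ (p : ZMod (2 ^ j))‖ ≤ η * t) :
    Summit.ValiantsHypothesis.ValiantsHypothesis.Theses.LiouvilleSarnak.AlignedTypeI :=
  alignedTypeI_of_logWeightedPrimeCharSums (logWeighted_of_primitive h)

end Summit.ValiantsHypothesis.ValiantsHypothesis.Theorems.LiouvilleSarnak.AlignedTypeI.CharactersModTwoN
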